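import Mathlib.Data.Nat.Bitwise
import Mathlib.Tactic.IntervalCases
import HarnessLib

/-!
# A kernel-evaluable 4-colouring search with TRIPLE constraints (static order, plain backtracking) — machinery and soundness

Framing (verbatim for the cell): lottery ticket; floor = certified bounds/negative ranges.

Instances of Part 2 of the kernel proof of `5 ≤ χ(ℝ²)` are colouring problems with two kinds of constraints: unit edges (adjacent vertices
get different colours) and designated `√3`-triples that must NOT be monochromatic.  This file is the search engine for them, kept as simple
as the instance sizes allow (de Grey's 61-vertex graph `K`): the state is four natural numbers `A₀ A₁ A₂ A₃` read as bit-sets (`v ∈ A_c` iff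
`v` is coloured `c`); the instance supplies the neighbour bit-words `nb v` and, for every vertex `v`, the list `tp v` of partner pairs `(a, b)`
such that `{v, a, b}` is a designated triple; colour `c` is admissible at `v` iff no neighbour and no complete partner pair of `v` lies in `A_c`
(`okCol`, `Nat` bit arithmetic evaluated by the kernel).  `search ord st` colours the vertices of the list `ord` in turn with every admissible
colour and answers `true` iff every branch dies before the list is exhausted; `search_sound` turns `search … = true` into "no colouring with
values `< 4` that respects the edges and the triples agrees with the state".  The order `ord` is a heuristic (the instance files choose it to keep
the tree small); soundness does not depend on it.  Seat udg g9.
-/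

namespace Summit.Ventures.DiscreteObjects.UnitDistance.KTri

/-- Select the word of the vertices coloured `c`. -/
def getA (A₀ A₁ A₂ A₃ c : ℕ) : ℕ := if c = 0 then A₀ else if c = 1 then A₁ else if c = 2 then A₂ else A₃

/-- Colour `c` is admissible at `v` given the word `Ac` of the vertices already coloured `c`: no neighbour of `v` is in `Ac` and no partner
pair of `v` lies entirely in `Ac`. -/
def okCol (nb : ℕ → ℕ) (tp : ℕ → List (ℕ × ℕ)) (Ac v : ℕ) : Bool :=
  decide (nb v &&& Ac = 0) && (tp v).all fun p => !(Nat.testBit Ac p.1 && Nat.testBit Ac p.2)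

/-- Add vertex `v` to the word of colour `c`. -/
def setA (A₀ A₁ A₂ A₃ v c : ℕ) : ℕ × ℕ × ℕ × ℕ :=
  if c = 0 then (A₀ ||| 2 ^ v, A₁, A₂, A₃) else if c = 1 then (A₀, A₁ ||| 2 ^ v, A₂, A₃)
  else if c = 2 then (A₀, A₁, A₂ ||| 2 ^ v, A₃) else (A₀, A₁, A₂, A₃ ||| 2 ^ v)

/-- THE SEARCH along the vertex list `ord`: `true` iff every way of colouring the listed vertices in turn, each with an admissible colour,
dies (exhausting the list counts as survival, hence `false`). -/
def search (nb : ℕ → ℕ) (tp : ℕ → List (ℕ × ℕ)) : List ℕ → ℕ × ℕ × ℕ × ℕ → Bool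
  | [], _ => false
  | v :: rest, (A₀, A₁, A₂, A₃) =>
      [0, 1, 2, 3].all fun c =>
        !okCol nb tp (getA A₀ A₁ A₂ A₃ c) v || search nb tp rest (setA A₀ A₁ A₂ A₃ v c)

/-! ## Soundness -/

/-- `col` is a proper colouring of the instance on the vertices `< n`: values `< 4`, adjacent (a set bit of the neighbour word) ⇒ different
colours, and no designated triple `{v, a, b}` (`(a, b) ∈ tp v`) monochromatic. -/
def Proper (nb : ℕ → ℕ) (tp : ℕ → List (ℕ × ℕ)) (n : ℕ) (col : ℕ → ℕ) : Prop :=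
  ∀ v, v < n → col v < 4 ∧ (∀ w, w < n → Nat.testBit (nb v) w = true → col w ≠ col v) ∧
    ∀ p ∈ tp v, ¬ (col p.1 = col v ∧ col p.2 = col v)

/-- The state agrees with `col`: every vertex recorded with colour `c` is `< n` and has colour `c`. -/
def Agree (n : ℕ) (col : ℕ → ℕ) (st : ℕ × ℕ × ℕ × ℕ) : Prop :=
  ∀ c, c < 4 → ∀ w, Nat.testBit (getA st.1 st.2.1 st.2.2.1 st.2.2.2 c) w = true → w < n ∧ col w = c

/-- Bits after `setA`: the word of colour `c` gains bit `v`, nothing else changes. -/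
theorem testBit_getA_setA (A₀ A₁ A₂ A₃ v c c' w : ℕ) (hc : c < 4) (hc' : c' < 4) :
    Nat.testBit (getA (setA A₀ A₁ A₂ A₃ v c).1 (setA A₀ A₁ A₂ A₃ v c).2.1 (setA A₀ A₁ A₂ A₃ v c).2.2.1
        (setA A₀ A₁ A₂ A₃ v c).2.2.2 c') w =
      (Nat.testBit (getA A₀ A₁ A₂ A₃ c') w || (decide (c' = c) && decide (v = w))) := by
  interval_cases c <;> interval_cases c' <;> simp [setA, getA, Nat.testBit_two_pow]

/-- `Agree` is preserved when the true colour of a vertex `< n` is recorded. -/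
theorem agree_setA {n : ℕ} {col : ℕ → ℕ} {A₀ A₁ A₂ A₃ : ℕ} (hA : Agree n col (A₀, A₁, A₂, A₃)) (v c : ℕ) (hv : v < n)
    (hc : c < 4) (hcv : col v = c) : Agree n col (setA A₀ A₁ A₂ A₃ v c) := by
  intro c' hc' w hw
  rw [testBit_getA_setA A₀ A₁ A₂ A₃ v c c' w hc hc'] at hw
  rcases Bool.or_eq_true_iff.1 hw with h | h
  · exact hA c' hc' w h
  · simp only [Bool.and_eq_true, decide_eq_true_eq] at h
    obtain ⟨rfl, rfl⟩ := h
    exact ⟨hv, hcv⟩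

/-- If the true colour of `v` is `c`, then `c` is admissible at `v` in any agreeing state. -/
theorem okCol_of_agree {nb : ℕ → ℕ} {tp : ℕ → List (ℕ × ℕ)} {n : ℕ} {col : ℕ → ℕ} (hP : Proper nb tp n col)
    {A₀ A₁ A₂ A₃ : ℕ} (hA : Agree n col (A₀, A₁, A₂, A₃)) (v c : ℕ) (hv : v < n) (hc : c < 4) (hcv : col v = c) :
    okCol nb tp (getA A₀ A₁ A₂ A₃ c) v = true := by
  obtain ⟨_, hadj, htri⟩ := hP v hv
  simp only [okCol, Bool.and_eq_true, decide_eq_true_eq, List.all_eq_true, Bool.not_eq_true', Bool.and_eq_false_iff]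
  refine ⟨?_, ?_⟩
  · apply Nat.eq_of_testBit_eq
    intro i
    rw [Nat.testBit_land, Nat.zero_testBit]
    cases hnb : Nat.testBit (nb v) i <;> cases hAi : Nat.testBit (getA A₀ A₁ A₂ A₃ c) i <;> simp only [Bool.and_self, Bool.and_false,
      Bool.and_true]
    obtain ⟨hi, hci⟩ := hA c hc i hAi
    exact absurd (hci.trans hcv.symm) (hadj i hi hnb)
  · intro p hp
    cases h1 : Nat.testBit (getA A₀ A₁ A₂ A₃ c) p.1
    · exact Or.inl rfl
    · cases h2 : Nat.testBit (getA A₀ A₁ A₂ A₃ c) p.2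
      · exact Or.inr rfl
      · exact absurd ⟨(hA c hc _ h1).2.trans hcv.symm, (hA c hc _ h2).2.trans hcv.symm⟩ (htri p hp)

/-- SOUNDNESS OF THE SEARCH: `search ord st = true` excludes every proper colouring agreeing with `st` (all listed vertices `< n`). -/
theorem search_sound {nb : ℕ → ℕ} {tp : ℕ → List (ℕ × ℕ)} {n : ℕ} {col : ℕ → ℕ} (hP : Proper nb tp n col) :
    ∀ (ord : List ℕ) (st : ℕ × ℕ × ℕ × ℕ), (∀ v ∈ ord, v < n) → search nb tp ord st = true → Agree n col st → False
  | [], st, _, h, _ => by simp [search] at h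
  | v :: rest, (A₀, A₁, A₂, A₃), hord, h, hA => by
      have hv : v < n := hord v List.mem_cons_self
      have hrest : ∀ w ∈ rest, w < n := fun w hw => hord w (List.mem_cons_of_mem v hw)
      have hcv : col v < 4 := (hP v hv).1
      unfold search at h
      simp only [List.all_cons, List.all_nil, Bool.and_true, Bool.and_eq_true] at h
      have key : ∀ c, col v = c →
          (!okCol nb tp (getA A₀ A₁ A₂ A₃ c) v || search nb tp rest (setA A₀ A₁ A₂ A₃ v c)) = true → False := by
        intro c hc hb
        have hc4 : c < 4 := hc ▸ hcv
        rw [okCol_of_agree hP hA v c hv hc4 hc] at hb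
        simp only [Bool.not_true, Bool.false_or] at hb
        exact search_sound hP rest _ hrest hb (agree_setA hA v c hv hc4 hc)
      obtain ⟨h0, h1, h2, h3⟩ := h
      interval_cases hcol : col v
      · exact key 0 rfl h0
      · exact key 1 rfl h1
      · exact key 2 rfl h2
      · exact key 3 rfl h3

/-- The empty state agrees with every colouring. -/
theorem agree_zero (n : ℕ) (col : ℕ → ℕ) : Agree n col (0, 0, 0, 0) := by
  intro c hc w hw
  interval_cases c <;> simp [getA] at hw

end Summit.Ventures.DiscreteObjects.UnitDistance.KTri
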